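import Literature.Analysis.FluidPDE.ClassicalEulerPointData
import Literature.Analysis.FunctionSpaces.TorusDiffMonomialBounds
import HarnessLib

/-!
# The symmetrised energy inequality for Euler-type first-order systems on `𝕋³`

Analysis/FluidPDE support file (everything proved; no definitions, no named facts). The abstract
form of the basic energy estimate for a SYMMETRISABLE quasilinear first-order system (Friedrichs
1954; Kato 1975; Majda 1984, Ch. 2 §2.1, (2.9)–(2.13) and the proof of Thm 2.2), specialised to the
shape of the linearised/differentiated non-isentropic Euler system in primitive variables
(`CompressibleEulerCommutators.continuity_word/momentum_word/temperature_word`): unknowns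
`R, U = (U₁,U₂,U₃), Θ` (scalar fields on a time set `S` times `𝕋³`) satisfying, at a time `t`,

  `∂ₜR + Σᵢ uᵢ∂ᵢR + Σₖ P ∂ₖUₖ = F`,
  `∂ₜUₖ + Σᵢ uᵢ∂ᵢUₖ + A ∂ₖR + Z ∂ₖΘ = Gₖ`,
  `∂ₜΘ + Σᵢ uᵢ∂ᵢΘ + Σₖ D ∂ₖUₖ = H`,

with smooth coefficient fields subject to the SYMMETRISER RELATION `P·Z = C·D` (for Euler:
`A = p_ρ/ρ`, `P = ρ`, `Z = p_ϑ/ρ`, `D = ϑp_ϑ/(ρe_ϑ)`, `C = ρe_ϑ/ϑ`). For the weighted energy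

  `e(s) = ∫_{𝕋³} (A R² + P |U|² + C Θ²)(s, y) dy`

the time derivative `∫ ∂ₜ(A R² + P|U|² + CΘ²)` (which IS `e'` within `S`, by
`Torus.IsSmoothSpaceTimeOn.hasDerivWithinAt_integral`) is bounded by

  `(L + 18 L²) · (‖R‖₂² + Σₖ‖Uₖ‖₂² + ‖Θ‖₂²) + 2L (‖R‖₂‖F‖₂ + Σₖ ‖Uₖ‖₂‖Gₖ‖₂ + ‖Θ‖₂‖H‖₂)`

(`abs_integral_timeDerivWithin_energy_le`), where `L` bounds, at time `t`, the sup norms of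
`A, P, C, Z, uᵢ`, of their first space derivatives and of `∂ₜA, ∂ₜP, ∂ₜC`. The three mechanisms
are: the transport terms are total derivatives up to `∫ ∂ᵢ(c uᵢ) g²` (`abs_integral_transport_le`),
the `R–U` and `U–Θ` couplings are total derivatives up to `∫ ∂ₖ(AP) R Uₖ`, `∫ ∂ₖ(PZ) Uₖ Θ`
thanks to the symmetriser relation (`abs_integral_coupling_le`), and the sources enter through
Cauchy–Schwarz (`abs_integral_weight_mul_mul_le`).

## References

* A. Majda, *Compressible Fluid Flow and Systems of Conservation Laws in Several Space
  Variables*, Springer 1984, Ch. 2 §2.1, (2.9)–(2.13), Thm 2.2. [Majda1984]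
* T. Kato, *The Cauchy problem for quasi-linear symmetric hyperbolic systems*, Arch. Rational
  Mech. Anal. 58 (1975) 181–205. [Kato1975]
* C. M. Dafermos, *Hyperbolic Conservation Laws in Continuum Physics*, 2nd ed., Springer 2005,
  §5.1, (5.1.20)–(5.1.25). [Dafermos2005]
-/

noncomputable section

open Set Function MeasureTheory
open scoped ContDiff

namespace Literature.Analysis.FluidPDE

namespace CompressibleEuler

open Literature.Analysis.FunctionSpaces Literature.Analysis.FunctionSpaces.Torus

/-! ### Three integral inequalities on `𝕋³` -/

/-- **Sources through Cauchy–Schwarz**: `|∫ a g F| ≤ L ‖g‖₂ ‖F‖₂` when `|a| ≤ L`. [folklore] -/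
theorem abs_integral_weight_mul_mul_le {a g F : UnitAddTorus (Fin 3) → ℝ} (hg : Continuous g) (hF : Continuous F)
    (ha : Continuous a) {L : ℝ} (hL : 0 ≤ L) (haL : ∀ y, |a y| ≤ L) :
    |∫ y, a y * g y * F y| ≤ L * (Real.sqrt (∫ y, g y ^ 2) * Real.sqrt (∫ y, F y ^ 2)) := by
  have h1 : ∀ (s : ℝ), s = 1 ∨ s = -1 → s * ∫ y, a y * g y * F y ≤
      L * (Real.sqrt (∫ y, g y ^ 2) * Real.sqrt (∫ y, F y ^ 2)) := by
    intro s hs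
    have hs2 : ∀ y, |s * a y| ≤ L := fun y => by
      rw [abs_mul]; rcases hs with rfl | rfl <;> simp [haL y]
    rw [← integral_const_mul]
    have e : (fun y => s * (a y * g y * F y)) = fun y => (s * a y * g y) * F y := by funext y; ring
    rw [e]
    calc ∫ y, s * a y * g y * F y
        ≤ Real.sqrt (∫ y, (s * a y * g y) ^ 2) * Real.sqrt (∫ y, F y ^ 2) :=
          integral_mul_le_sqrt_mul_sqrt ((continuous_const.mul ha).mul hg) hF
      _ ≤ (L * Real.sqrt (∫ y, g y ^ 2)) * Real.sqrt (∫ y, F y ^ 2) :=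
          mul_le_mul_of_nonneg_right (sqrt_integral_sq_mul_le_of_abs_le hg hL hs2) (Real.sqrt_nonneg _)
      _ = L * (Real.sqrt (∫ y, g y ^ 2) * Real.sqrt (∫ y, F y ^ 2)) := by ring
  rw [abs_le]
  constructor
  · have := h1 (-1) (Or.inr rfl); linarith
  · have := h1 1 (Or.inl rfl); linarith

/-- **Integration by parts on the torus**: `∫ a ∂ᵢb = -∫ (∂ᵢa) b` for smooth functions.
[cite: Evans2010, App. C.2 Thm. 2] -/
theorem integral_mul_partialDeriv_eq_neg_integral {a b : UnitAddTorus (Fin 3) → ℝ} (ha : IsSmooth a) (hb : IsSmooth b)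
    (i : Fin 3) : ∫ x, a x * partialDeriv i b x = -∫ x, partialDeriv i a x * b x := by
  have ha1 : IsContDiff 1 a := ha.isContDiff (by simp)
  have hb1 : IsContDiff 1 b := hb.isContDiff (by simp)
  have hprod : IsContDiff 1 (fun y => a y * b y) := ha1.mul hb1
  have h0 := integral_partialDeriv_eq_zero_of_isContDiff hprod i
  have hfun : (fun x => partialDeriv i (fun y => a y * b y) x) =
      fun x => a x * partialDeriv i b x + partialDeriv i a x * b x := by
    funext x; exact partialDeriv_mul ha1 hb1 i x
  have hI1 : Integrable fun x => a x * partialDeriv i b x :=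
    (ha.continuous.mul (hb.partialDeriv i).continuous).integrable_unitAddTorus
  have hI2 : Integrable fun x => partialDeriv i a x * b x :=
    ((ha.partialDeriv i).continuous.mul hb.continuous).integrable_unitAddTorus
  rw [hfun, integral_add hI1 hI2] at h0
  linarith

/-- **Transport terms are harmless**: for smooth `c, vᵢ, g` on `𝕋³` with `|∂ᵢ(c vᵢ)| ≤ B`,
`|∫ c Σᵢ vᵢ g ∂ᵢg| ≤ (3B/2) ∫ g²` (since `2∫ c vᵢ g ∂ᵢg = -∫ ∂ᵢ(c vᵢ) g²`).
[cite: Majda1984, Ch. 2 §2.1 (2.11)] -/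
theorem abs_integral_transport_le {c g : UnitAddTorus (Fin 3) → ℝ} {v : Fin 3 → UnitAddTorus (Fin 3) → ℝ} (hc : IsSmooth c)
    (hv : ∀ i, IsSmooth (v i)) (hg : IsSmooth g) {B : ℝ}
    (hB : ∀ i y, |partialDeriv i (fun y => c y * v i y) y| ≤ B) :
    |∫ y, c y * ∑ i, v i y * (g y * partialDeriv i g y)| ≤ 3 * B / 2 * ∫ y, g y ^ 2 := by
  have hB0 : 0 ≤ B := (abs_nonneg _).trans (hB 0 0)
  have hcv : ∀ i, IsSmooth fun y => c y * v i y := fun i => ContDiff.mul hc (hv i)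
  have hg1 : IsContDiff 1 g := hg.isContDiff (by simp)
  -- each direction separately
  have hone : ∀ i, |∫ y, (c y * v i y) * (g y * partialDeriv i g y)| ≤ B / 2 * ∫ y, g y ^ 2 := by
    intro i
    have hcvg : IsSmooth fun y => c y * v i y * g y := ContDiff.mul (hcv i) hg
    -- `∫ (c vᵢ g) ∂ᵢg = -∫ ∂ᵢ(c vᵢ g) g = -∫ [(c vᵢ) ∂ᵢg + ∂ᵢ(c vᵢ) g] g`
    have hibp := integral_mul_partialDeriv_eq_neg_integral hcvg hg i
    have hpd : ∀ y, partialDeriv i (fun y => c y * v i y * g y) y =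
        (c y * v i y) * partialDeriv i g y + partialDeriv i (fun y => c y * v i y) y * g y := fun y =>
      partialDeriv_mul ((hcv i).isContDiff (by simp)) hg1 i y
    have hI1 : Integrable fun y => (c y * v i y) * partialDeriv i g y * g y :=
      (((hcv i).continuous.mul (hg.partialDeriv i).continuous).mul hg.continuous).integrable_unitAddTorus
    have hI2 : Integrable fun y => partialDeriv i (fun y => c y * v i y) y * g y * g y :=
      ((((hcv i).partialDeriv i).continuous.mul hg.continuous).mul hg.continuous).integrable_unitAddTorus
    have hsplit : ∫ y, partialDeriv i (fun y => c y * v i y * g y) y * g y =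
        (∫ y, (c y * v i y) * partialDeriv i g y * g y) +
          ∫ y, partialDeriv i (fun y => c y * v i y) y * g y * g y := by
      rw [← integral_add hI1 hI2]
      exact integral_congr_ae (ae_of_all _ fun y => by beta_reduce; rw [hpd y]; ring)
    have e1 : ∫ y, (c y * v i y) * (g y * partialDeriv i g y) = ∫ y, (c y * v i y * g y) * partialDeriv i g y :=
      integral_congr_ae (ae_of_all _ fun y => by ring)
    have e2 : ∫ y, (c y * v i y) * partialDeriv i g y * g y = ∫ y, (c y * v i y * g y) * partialDeriv i g y :=
      integral_congr_ae (ae_of_all _ fun y => by ring)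
    have key : 2 * ∫ y, (c y * v i y * g y) * partialDeriv i g y =
        -∫ y, partialDeriv i (fun y => c y * v i y) y * g y * g y := by
      rw [hsplit, e2] at hibp; linarith
    have hbound : |∫ y, partialDeriv i (fun y => c y * v i y) y * g y * g y| ≤ B * ∫ y, g y ^ 2 := by
      rw [← integral_const_mul]
      refine (abs_integral_le_integral_abs).trans (integral_mono hI2.abs
        (((hg.continuous.pow 2).const_mul B).integrable_unitAddTorus) fun y => ?_)
      show |partialDeriv i (fun y => c y * v i y) y * g y * g y| ≤ B * g y ^ 2
      rw [mul_assoc, abs_mul, show g y * g y = g y ^ 2 by ring, abs_of_nonneg (sq_nonneg (g y))]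
      exact mul_le_mul_of_nonneg_right (hB i y) (sq_nonneg _)
    rw [e1]
    have : |∫ y, c y * v i y * g y * partialDeriv i g y| =
        |∫ y, partialDeriv i (fun y => c y * v i y) y * g y * g y| / 2 := by
      rw [show (∫ y, c y * v i y * g y * partialDeriv i g y) =
        -(∫ y, partialDeriv i (fun y => c y * v i y) y * g y * g y) / 2 by linarith, abs_div, abs_neg]
      norm_num
    rw [this]
    linarith
  -- sum over the directions
  have hI : ∀ i, Integrable fun y => (c y * v i y) * (g y * partialDeriv i g y) := fun i =>
    ((hcv i).continuous.mul (hg.continuous.mul (hg.partialDeriv i).continuous)).integrable_unitAddTorus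
  have e : ∫ y, c y * ∑ i, v i y * (g y * partialDeriv i g y) =
      ∑ i, ∫ y, (c y * v i y) * (g y * partialDeriv i g y) := by
    rw [← integral_finsetSum _ fun i _ => hI i]
    refine integral_congr_ae (ae_of_all _ fun y => ?_)
    show c y * ∑ i, v i y * (g y * partialDeriv i g y) = ∑ i, c y * v i y * (g y * partialDeriv i g y)
    rw [Finset.mul_sum]
    exact Finset.sum_congr rfl fun i _ => by ring
  rw [e]
  calc |∑ i, ∫ y, c y * v i y * (g y * partialDeriv i g y)|
      ≤ ∑ i, |∫ y, c y * v i y * (g y * partialDeriv i g y)| := Finset.abs_sum_le_sum_abs _ _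
    _ ≤ ∑ _i : Fin 3, B / 2 * ∫ y, g y ^ 2 := Finset.sum_le_sum fun i _ => hone i
    _ = 3 * B / 2 * ∫ y, g y ^ 2 := by simp; ring

/-- **Symmetric couplings are harmless**: for smooth `c, g, hₖ` on `𝕋³` with `|∂ₖc| ≤ B`,
`|∫ c Σₖ (g ∂ₖhₖ + hₖ ∂ₖg)| ≤ (B/2) Σₖ (∫ g² + ∫ hₖ²)` (since `∫ c ∂ₖ(g hₖ) = -∫ (∂ₖc) g hₖ`).
[cite: Majda1984, Ch. 2 §2.1 (2.11)] -/
theorem abs_integral_coupling_le {c g : UnitAddTorus (Fin 3) → ℝ} {h : Fin 3 → UnitAddTorus (Fin 3) → ℝ} (hc : IsSmooth c)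
    (hg : IsSmooth g) (hh : ∀ k, IsSmooth (h k)) {B : ℝ} (hB : ∀ k y, |partialDeriv k c y| ≤ B) :
    |∫ y, c y * ∑ k, (g y * partialDeriv k (h k) y + h k y * partialDeriv k g y)| ≤
      B / 2 * ∑ k, ((∫ y, g y ^ 2) + ∫ y, h k y ^ 2) := by
  have hB0 : 0 ≤ B := (abs_nonneg _).trans (hB 0 0)
  have hg1 : IsContDiff 1 g := hg.isContDiff (by simp)
  have hone : ∀ k, |∫ y, c y * (g y * partialDeriv k (h k) y + h k y * partialDeriv k g y)| ≤
      B / 2 * ((∫ y, g y ^ 2) + ∫ y, h k y ^ 2) := by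
    intro k
    have hgh : IsSmooth fun y => g y * h k y := ContDiff.mul hg (hh k)
    have hpd : ∀ y, partialDeriv k (fun y => g y * h k y) y =
        g y * partialDeriv k (h k) y + partialDeriv k g y * h k y := fun y =>
      partialDeriv_mul hg1 ((hh k).isContDiff (by simp)) k y
    have hibp := integral_mul_partialDeriv_eq_neg_integral hc hgh k
    have e1 : ∫ y, c y * (g y * partialDeriv k (h k) y + h k y * partialDeriv k g y) =
        ∫ y, c y * partialDeriv k (fun y => g y * h k y) y :=
      integral_congr_ae (ae_of_all _ fun y => by beta_reduce; rw [hpd y]; ring)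
    rw [e1, hibp, abs_neg]
    have hI : Integrable fun y => partialDeriv k c y * (g y * h k y) :=
      ((hc.partialDeriv k).continuous.mul (hg.continuous.mul (hh k).continuous)).integrable_unitAddTorus
    have hI2 : Integrable fun y => B / 2 * (g y ^ 2 + h k y ^ 2) :=
      (((hg.continuous.pow 2).add ((hh k).continuous.pow 2)).const_mul _).integrable_unitAddTorus
    calc |∫ y, partialDeriv k c y * (g y * h k y)| ≤ ∫ y, |partialDeriv k c y * (g y * h k y)| :=
          abs_integral_le_integral_abs
      _ ≤ ∫ y, B / 2 * (g y ^ 2 + h k y ^ 2) := by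
          refine integral_mono hI.abs hI2 fun y => ?_
          show |partialDeriv k c y * (g y * h k y)| ≤ B / 2 * (g y ^ 2 + h k y ^ 2)
          rw [abs_mul]
          have h2 : |g y * h k y| ≤ (g y ^ 2 + h k y ^ 2) / 2 := by
            rw [abs_le]; constructor <;> nlinarith [sq_nonneg (g y + h k y), sq_nonneg (g y - h k y)]
          calc |partialDeriv k c y| * |g y * h k y| ≤ B * ((g y ^ 2 + h k y ^ 2) / 2) :=
                mul_le_mul (hB k y) h2 (abs_nonneg _) hB0
            _ = B / 2 * (g y ^ 2 + h k y ^ 2) := by ring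
      _ = B / 2 * ((∫ y, g y ^ 2) + ∫ y, h k y ^ 2) := by
          have i1 : Integrable fun y => g y ^ 2 := (hg.continuous.pow 2).integrable_unitAddTorus
          have i2 : Integrable fun y => h k y ^ 2 := ((hh k).continuous.pow 2).integrable_unitAddTorus
          rw [integral_const_mul, integral_add i1 i2]
  have hI : ∀ k, Integrable fun y => c y * (g y * partialDeriv k (h k) y + h k y * partialDeriv k g y) :=
    fun k => (hc.continuous.mul ((hg.continuous.mul ((hh k).partialDeriv k).continuous).add
      ((hh k).continuous.mul (hg.partialDeriv k).continuous))).integrable_unitAddTorus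
  have e : ∫ y, c y * ∑ k, (g y * partialDeriv k (h k) y + h k y * partialDeriv k g y) =
      ∑ k, ∫ y, c y * (g y * partialDeriv k (h k) y + h k y * partialDeriv k g y) := by
    rw [← integral_finsetSum _ fun k _ => hI k]
    exact integral_congr_ae (ae_of_all _ fun y => by simp only [Finset.mul_sum])
  rw [e, Finset.mul_sum]
  exact (Finset.abs_sum_le_sum_abs _ _).trans (Finset.sum_le_sum fun k _ => hone k)

/-! ### Time derivatives of finite sums and squares -/

/-- One-sided time derivatives of finite sums of jointly smooth fields. [folklore] -/
theorem timeDerivWithin_finset_sum {ι : Type*} (s : Finset ι) {S : Set ℝ} {w : ι → ℝ → UnitAddTorus (Fin 3) → ℝ}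
    (hw : ∀ i ∈ s, IsSmoothSpaceTimeOn S (w i)) (hS : UniqueDiffOn ℝ S) {t : ℝ} (ht : t ∈ S) (x : UnitAddTorus (Fin 3)) :
    timeDerivWithin S (fun τ y => ∑ i ∈ s, w i τ y) t x = ∑ i ∈ s, timeDerivWithin S (w i) t x :=
  (HasDerivWithinAt.fun_sum fun i hi => (hw i hi).hasDerivWithinAt_slice ht x).derivWithin (hS t ht)

/-- `∂ₜ(c g²) = (∂ₜc) g² + 2 c g ∂ₜg` for jointly smooth scalar fields. [folklore] -/
theorem timeDerivWithin_weight_mul_sq {S : Set ℝ} {c g : ℝ → UnitAddTorus (Fin 3) → ℝ} (hc : IsSmoothSpaceTimeOn S c)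
    (hg : IsSmoothSpaceTimeOn S g) (hS : UniqueDiffOn ℝ S) {t : ℝ} (ht : t ∈ S) (x : UnitAddTorus (Fin 3)) :
    timeDerivWithin S (fun s y => c s y * g s y ^ 2) t x =
      timeDerivWithin S c t x * g t x ^ 2 + 2 * c t x * g t x * timeDerivWithin S g t x := by
  have e : (fun s y => c s y * g s y ^ 2) = fun s y => c s y * (g s y * g s y) := by
    funext s y; ring
  rw [e, timeDerivWithin_mul hc (hg.mul hg) hS ht x, timeDerivWithin_mul hg hg hS ht x]
  ring

/-- `∂ₜ(g²) = 2 g ∂ₜg` for a jointly smooth scalar field. [folklore] -/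
theorem timeDerivWithin_sq {S : Set ℝ} {g : ℝ → UnitAddTorus (Fin 3) → ℝ} (hg : IsSmoothSpaceTimeOn S g)
    (hS : UniqueDiffOn ℝ S) {t : ℝ} (ht : t ∈ S) (x : UnitAddTorus (Fin 3)) :
    timeDerivWithin S (fun s y => g s y ^ 2) t x = 2 * g t x * timeDerivWithin S g t x := by
  have e : (fun s y => g s y ^ 2) = fun s y => g s y * g s y := by funext s y; ring
  rw [e, timeDerivWithin_mul hg hg hS ht x]; ring

/-! ### The energy inequality -/

/-- **The symmetrised energy inequality** (abstract form of Majda 1984, (2.11)–(2.13), for the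
shape of the differentiated primitive Euler system). See the module docstring for the statement;
all sup bounds are at the time `t`, `L ≥ 0`. [cite: Majda1984, Ch. 2 §2.1 Thm 2.2] -/
theorem abs_integral_timeDerivWithin_energy_le {S : Set ℝ} (hS : UniqueDiffOn ℝ S) {t : ℝ} (ht : t ∈ S)
    {A P C Z D R Θ : ℝ → UnitAddTorus (Fin 3) → ℝ} {U uu : Fin 3 → ℝ → UnitAddTorus (Fin 3) → ℝ}
    (hA : IsSmoothSpaceTimeOn S A) (hP : IsSmoothSpaceTimeOn S P) (hC : IsSmoothSpaceTimeOn S C)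
    (hZ : IsSmoothSpaceTimeOn S Z) (hR : IsSmoothSpaceTimeOn S R)
    (hΘ : IsSmoothSpaceTimeOn S Θ) (hU : ∀ k, IsSmoothSpaceTimeOn S (U k))
    (hu : ∀ i, IsSmoothSpaceTimeOn S (uu i))
    {F H : UnitAddTorus (Fin 3) → ℝ} {G : Fin 3 → UnitAddTorus (Fin 3) → ℝ} (hF : Continuous F) (hG : ∀ k, Continuous (G k))
    (hH : Continuous H)
    (hReq : ∀ y, timeDerivWithin S R t y + (∑ i, uu i t y * partialDeriv i (R t) y) +
      ∑ k, P t y * partialDeriv k (U k t) y = F y)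
    (hUeq : ∀ k y, timeDerivWithin S (U k) t y + (∑ i, uu i t y * partialDeriv i (U k t) y) +
      (A t y * partialDeriv k (R t) y + Z t y * partialDeriv k (Θ t) y) = G k y)
    (hΘeq : ∀ y, timeDerivWithin S Θ t y + (∑ i, uu i t y * partialDeriv i (Θ t) y) +
      ∑ k, D t y * partialDeriv k (U k t) y = H y)
    (hPZ : ∀ y, P t y * Z t y = C t y * D t y)
    {L : ℝ} (hL : 0 ≤ L)
    (bA : ∀ y, |A t y| ≤ L) (bP : ∀ y, |P t y| ≤ L) (bC : ∀ y, |C t y| ≤ L) (bZ : ∀ y, |Z t y| ≤ L)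
    (bu : ∀ i y, |uu i t y| ≤ L)
    (bAt : ∀ y, |timeDerivWithin S A t y| ≤ L) (bPt : ∀ y, |timeDerivWithin S P t y| ≤ L)
    (bCt : ∀ y, |timeDerivWithin S C t y| ≤ L)
    (bAx : ∀ i y, |partialDeriv i (A t) y| ≤ L) (bPx : ∀ i y, |partialDeriv i (P t) y| ≤ L)
    (bCx : ∀ i y, |partialDeriv i (C t) y| ≤ L) (bZx : ∀ i y, |partialDeriv i (Z t) y| ≤ L)
    (bux : ∀ i j y, |partialDeriv i (uu j t) y| ≤ L) :
    |∫ y, timeDerivWithin S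
        (fun s y => A s y * R s y ^ 2 + P s y * (∑ k, U k s y ^ 2) + C s y * Θ s y ^ 2) t y| ≤
      (L + 18 * L ^ 2) * ((∫ y, R t y ^ 2) + (∑ k, ∫ y, U k t y ^ 2) + ∫ y, Θ t y ^ 2) +
        2 * L * (Real.sqrt (∫ y, R t y ^ 2) * Real.sqrt (∫ y, F y ^ 2) +
          (∑ k, Real.sqrt (∫ y, U k t y ^ 2) * Real.sqrt (∫ y, G k y ^ 2)) +
          Real.sqrt (∫ y, Θ t y ^ 2) * Real.sqrt (∫ y, H y ^ 2)) := by
  -- smoothness at time `t`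
  have sA : IsSmooth (A t) := hA.isSmooth_slice ht
  have sP : IsSmooth (P t) := hP.isSmooth_slice ht
  have sC : IsSmooth (C t) := hC.isSmooth_slice ht
  have sZ : IsSmooth (Z t) := hZ.isSmooth_slice ht
  have sR : IsSmooth (R t) := hR.isSmooth_slice ht
  have sΘ : IsSmooth (Θ t) := hΘ.isSmooth_slice ht
  have sU : ∀ k, IsSmooth (U k t) := fun k => (hU k).isSmooth_slice ht
  have su : ∀ i, IsSmooth (uu i t) := fun i => (hu i).isSmooth_slice ht
  have cAt : Continuous (timeDerivWithin S A t) := (hA.isSmooth_timeDerivWithin hS ht).continuous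
  have cPt : Continuous (timeDerivWithin S P t) := (hP.isSmooth_timeDerivWithin hS ht).continuous
  have cCt : Continuous (timeDerivWithin S C t) := (hC.isSmooth_timeDerivWithin hS ht).continuous
  have cA := sA.continuous; have cP := sP.continuous; have cC := sC.continuous; have cZ := sZ.continuous
  have cR := sR.continuous; have cΘ := sΘ.continuous
  have cU : ∀ k, Continuous (U k t) := fun k => (sU k).continuous
  have cu : ∀ i, Continuous (uu i t) := fun i => (su i).continuous
  have cdR : ∀ i, Continuous (partialDeriv i (R t)) := fun i => (sR.partialDeriv i).continuous
  have cdΘ : ∀ i, Continuous (partialDeriv i (Θ t)) := fun i => (sΘ.partialDeriv i).continuous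
  have cdU : ∀ i k, Continuous (partialDeriv i (U k t)) := fun i k => ((sU k).partialDeriv i).continuous
  -- the auxiliary integrands
  set I : UnitAddTorus (Fin 3) → ℝ := fun y => timeDerivWithin S A t y * R t y ^ 2 +
    timeDerivWithin S P t y * (∑ k, U k t y ^ 2) + timeDerivWithin S C t y * Θ t y ^ 2 with hIdef
  set II : UnitAddTorus (Fin 3) → ℝ := fun y => 2 * (A t y * R t y * F y) + (∑ k, 2 * (P t y * U k t y * G k y)) +
    2 * (C t y * Θ t y * H y) with hIIdef
  set ψ₁ : UnitAddTorus (Fin 3) → ℝ := fun y => A t y * ∑ i, uu i t y * (R t y * partialDeriv i (R t) y) with hψ₁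
  set ψ₂ : Fin 3 → UnitAddTorus (Fin 3) → ℝ := fun k y =>
    P t y * ∑ i, uu i t y * (U k t y * partialDeriv i (U k t) y) with hψ₂
  set ψ₃ : UnitAddTorus (Fin 3) → ℝ := fun y => C t y * ∑ i, uu i t y * (Θ t y * partialDeriv i (Θ t) y) with hψ₃
  set ψ₄ : UnitAddTorus (Fin 3) → ℝ := fun y => (A t y * P t y) *
    ∑ k, (R t y * partialDeriv k (U k t) y + U k t y * partialDeriv k (R t) y) with hψ₄
  set ψ₅ : UnitAddTorus (Fin 3) → ℝ := fun y => (P t y * Z t y) *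
    ∑ k, (Θ t y * partialDeriv k (U k t) y + U k t y * partialDeriv k (Θ t) y) with hψ₅
  -- Step 1: the pointwise identity
  have hsq : ∀ k, IsSmoothSpaceTimeOn S (fun s y => U k s y ^ 2) := fun k => by
    simpa only [sq] using (hU k).mul (hU k)
  have hsum : IsSmoothSpaceTimeOn S (fun s y => ∑ k, U k s y ^ 2) :=
    IsSmoothSpaceTimeOn.sum fun k _ => hsq k
  have h1 : IsSmoothSpaceTimeOn S (fun s y => A s y * R s y ^ 2) := by
    simpa only [sq] using hA.mul (hR.mul hR)
  have h2 : IsSmoothSpaceTimeOn S (fun s y => P s y * ∑ k, U k s y ^ 2) := hP.mul hsum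
  have h3 : IsSmoothSpaceTimeOn S (fun s y => C s y * Θ s y ^ 2) := by
    simpa only [sq] using hC.mul (hΘ.mul hΘ)
  have hpt : ∀ y, timeDerivWithin S
      (fun s y => A s y * R s y ^ 2 + P s y * (∑ k, U k s y ^ 2) + C s y * Θ s y ^ 2) t y =
      I y + II y - 2 * ψ₁ y - 2 * (∑ k, ψ₂ k y) - 2 * ψ₃ y - 2 * ψ₄ y - 2 * ψ₅ y := by
    intro y
    rw [timeDerivWithin_add (h1.add h2) h3 hS ht y, timeDerivWithin_add h1 h2 hS ht y,
      timeDerivWithin_weight_mul_sq hA hR hS ht y, timeDerivWithin_mul hP hsum hS ht y,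
      timeDerivWithin_finset_sum _ (fun k _ => hsq k) hS ht y, timeDerivWithin_weight_mul_sq hC hΘ hS ht y]
    simp only [fun k => timeDerivWithin_sq (hU k) hS ht y]
    have eR : timeDerivWithin S R t y =
        F y - (∑ i, uu i t y * partialDeriv i (R t) y) - ∑ k, P t y * partialDeriv k (U k t) y := by
      linarith [hReq y]
    have eU : ∀ k, timeDerivWithin S (U k) t y = G k y - (∑ i, uu i t y * partialDeriv i (U k t) y) -
        (A t y * partialDeriv k (R t) y + Z t y * partialDeriv k (Θ t) y) := fun k => by
      linarith [hUeq k y]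
    have eΘ : timeDerivWithin S Θ t y =
        H y - (∑ i, uu i t y * partialDeriv i (Θ t) y) - ∑ k, D t y * partialDeriv k (U k t) y := by
      linarith [hΘeq y]
    rw [eR, eΘ]
    simp only [eU, hIdef, hIIdef, hψ₁, hψ₂, hψ₃, hψ₄, hψ₅, Fin.sum_univ_three]
    linear_combination (2 * Θ t y * (partialDeriv 0 (U 0 t) y + partialDeriv 1 (U 1 t) y +
      partialDeriv 2 (U 2 t) y)) * hPZ y
  -- Step 2: continuity of the pieces
  have cI : Continuous I := ((cAt.mul (cR.pow 2)).add (cPt.mul (continuous_finsetSum _ fun k _ =>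
    (cU k).pow 2))).add (cCt.mul (cΘ.pow 2))
  have cII : Continuous II := ((continuous_const.mul ((cA.mul cR).mul hF)).add
    (continuous_finsetSum _ fun k _ => continuous_const.mul ((cP.mul (cU k)).mul (hG k)))).add
    (continuous_const.mul ((cC.mul cΘ).mul hH))
  have cψ₁ : Continuous ψ₁ := cA.mul (continuous_finsetSum _ fun i _ => (cu i).mul (cR.mul (cdR i)))
  have cψ₂ : ∀ k, Continuous (ψ₂ k) := fun k =>
    cP.mul (continuous_finsetSum _ fun i _ => (cu i).mul ((cU k).mul (cdU i k)))
  have cψ₃ : Continuous ψ₃ := cC.mul (continuous_finsetSum _ fun i _ => (cu i).mul (cΘ.mul (cdΘ i)))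
  have cψ₄ : Continuous ψ₄ := (cA.mul cP).mul (continuous_finsetSum _ fun k _ =>
    (cR.mul (cdU k k)).add ((cU k).mul (cdR k)))
  have cψ₅ : Continuous ψ₅ := (cP.mul cZ).mul (continuous_finsetSum _ fun k _ =>
    (cΘ.mul (cdU k k)).add ((cU k).mul (cdΘ k)))
  have cψ₂s : Continuous fun y => ∑ k, ψ₂ k y := continuous_finsetSum _ fun k _ => cψ₂ k
  -- Step 3: the integral splits
  have integ : ∀ {φ : UnitAddTorus (Fin 3) → ℝ}, Continuous φ → Integrable φ := fun h => h.integrable_unitAddTorus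
  have c1 : Continuous fun y => I y + II y := cI.add cII
  have c2 : Continuous fun y => I y + II y - 2 * ψ₁ y := c1.sub (continuous_const.mul cψ₁)
  have c3 : Continuous fun y => I y + II y - 2 * ψ₁ y - 2 * ∑ k, ψ₂ k y :=
    c2.sub (continuous_const.mul cψ₂s)
  have c4 : Continuous fun y => I y + II y - 2 * ψ₁ y - 2 * (∑ k, ψ₂ k y) - 2 * ψ₃ y :=
    c3.sub (continuous_const.mul cψ₃)
  have c5 : Continuous fun y => I y + II y - 2 * ψ₁ y - 2 * (∑ k, ψ₂ k y) - 2 * ψ₃ y - 2 * ψ₄ y :=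
    c4.sub (continuous_const.mul cψ₄)
  have d1 : Continuous fun y => 2 * ψ₁ y := continuous_const.mul cψ₁
  have d2 : Continuous fun y => 2 * ∑ k, ψ₂ k y := continuous_const.mul cψ₂s
  have d3 : Continuous fun y => 2 * ψ₃ y := continuous_const.mul cψ₃
  have d4 : Continuous fun y => 2 * ψ₄ y := continuous_const.mul cψ₄
  have d5 : Continuous fun y => 2 * ψ₅ y := continuous_const.mul cψ₅
  have e0 : ∫ y, timeDerivWithin S
      (fun s y => A s y * R s y ^ 2 + P s y * (∑ k, U k s y ^ 2) + C s y * Θ s y ^ 2) t y =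
      (∫ y, I y) + (∫ y, II y) - 2 * (∫ y, ψ₁ y) - 2 * (∑ k, ∫ y, ψ₂ k y) - 2 * (∫ y, ψ₃ y) -
        2 * (∫ y, ψ₄ y) - 2 * ∫ y, ψ₅ y := by
    rw [integral_congr_ae (ae_of_all _ hpt)]
    rw [integral_sub (integ c5) (integ d5), integral_sub (integ c4) (integ d4),
      integral_sub (integ c3) (integ d3), integral_sub (integ c2) (integ d2),
      integral_sub (integ c1) (integ d1), integral_add (integ cI) (integ cII),
      integral_const_mul, integral_const_mul, integral_const_mul, integral_const_mul, integral_const_mul,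
      integral_finsetSum _ fun k _ => integ (cψ₂ k)]
  -- Step 4: the bounds
  have nR0 : 0 ≤ ∫ y, R t y ^ 2 := integral_nonneg fun y => sq_nonneg _
  have nU0 : ∀ k, 0 ≤ ∫ y, U k t y ^ 2 := fun k => integral_nonneg fun y => sq_nonneg _
  have nΘ0 : 0 ≤ ∫ y, Θ t y ^ 2 := integral_nonneg fun y => sq_nonneg _
  have nUs0 : 0 ≤ ∑ k, ∫ y, U k t y ^ 2 := Finset.sum_nonneg fun k _ => nU0 k
  -- (I)
  have bI : |∫ y, I y| ≤ L * ((∫ y, R t y ^ 2) + (∑ k, ∫ y, U k t y ^ 2) + ∫ y, Θ t y ^ 2) := by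
    have hpt' : ∀ y, |I y| ≤ L * (R t y ^ 2 + (∑ k, U k t y ^ 2) + Θ t y ^ 2) := by
      intro y
      have hs0 : 0 ≤ ∑ k, U k t y ^ 2 := Finset.sum_nonneg fun k _ => sq_nonneg _
      calc |I y| ≤ |timeDerivWithin S A t y * R t y ^ 2| + |timeDerivWithin S P t y * ∑ k, U k t y ^ 2| +
            |timeDerivWithin S C t y * Θ t y ^ 2| := abs_add_three _ _ _
        _ ≤ L * R t y ^ 2 + L * (∑ k, U k t y ^ 2) + L * Θ t y ^ 2 := by
            rw [abs_mul, abs_mul, abs_mul, abs_of_nonneg (sq_nonneg (R t y)), abs_of_nonneg hs0,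
              abs_of_nonneg (sq_nonneg (Θ t y))]
            gcongr
            · exact bAt y
            · exact bPt y
            · exact bCt y
        _ = L * (R t y ^ 2 + (∑ k, U k t y ^ 2) + Θ t y ^ 2) := by ring
    have cs : Continuous fun y => ∑ k, U k t y ^ 2 := continuous_finsetSum _ fun k _ => (cU k).pow 2
    have cRU : Continuous fun y => R t y ^ 2 + ∑ k, U k t y ^ 2 := (cR.pow 2).add cs
    have cRUΘ : Continuous fun y => R t y ^ 2 + (∑ k, U k t y ^ 2) + Θ t y ^ 2 := cRU.add (cΘ.pow 2)
    have cb : Continuous fun y => L * (R t y ^ 2 + (∑ k, U k t y ^ 2) + Θ t y ^ 2) :=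
      continuous_const.mul cRUΘ
    have cR2 : Continuous fun y => R t y ^ 2 := cR.pow 2
    have cΘ2 : Continuous fun y => Θ t y ^ 2 := cΘ.pow 2
    have cU2 : ∀ k, Continuous fun y => U k t y ^ 2 := fun k => (cU k).pow 2
    calc |∫ y, I y| ≤ ∫ y, |I y| := abs_integral_le_integral_abs
      _ ≤ ∫ y, L * (R t y ^ 2 + (∑ k, U k t y ^ 2) + Θ t y ^ 2) :=
          integral_mono (integ cI).abs (integ cb) hpt'
      _ = L * ((∫ y, R t y ^ 2) + (∑ k, ∫ y, U k t y ^ 2) + ∫ y, Θ t y ^ 2) := by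
          rw [integral_const_mul, integral_add (integ cRU) (integ cΘ2), integral_add (integ cR2) (integ cs),
            integral_finsetSum _ fun k _ => integ (cU2 k)]
  -- (II)
  have bII : |∫ y, II y| ≤ 2 * L * (Real.sqrt (∫ y, R t y ^ 2) * Real.sqrt (∫ y, F y ^ 2) +
      (∑ k, Real.sqrt (∫ y, U k t y ^ 2) * Real.sqrt (∫ y, G k y ^ 2)) +
      Real.sqrt (∫ y, Θ t y ^ 2) * Real.sqrt (∫ y, H y ^ 2)) := by
    have cARF : Continuous fun y => 2 * (A t y * R t y * F y) := continuous_const.mul ((cA.mul cR).mul hF)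
    have cPUG : ∀ k, Continuous fun y => 2 * (P t y * U k t y * G k y) := fun k =>
      continuous_const.mul ((cP.mul (cU k)).mul (hG k))
    have cPUGs : Continuous fun y => ∑ k, 2 * (P t y * U k t y * G k y) := continuous_finsetSum _ fun k _ => cPUG k
    have cCΘH : Continuous fun y => 2 * (C t y * Θ t y * H y) := continuous_const.mul ((cC.mul cΘ).mul hH)
    have c12 : Continuous fun y => 2 * (A t y * R t y * F y) + ∑ k, 2 * (P t y * U k t y * G k y) :=
      cARF.add cPUGs
    have e : ∫ y, II y = 2 * (∫ y, A t y * R t y * F y) + (∑ k, 2 * ∫ y, P t y * U k t y * G k y) +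
        2 * ∫ y, C t y * Θ t y * H y := by
      simp only [hIIdef]
      rw [integral_add (integ c12) (integ cCΘH), integral_add (integ cARF) (integ cPUGs),
        integral_const_mul, integral_const_mul, integral_finsetSum _ fun k _ => integ (cPUG k)]
      simp only [integral_const_mul]
    rw [e]
    have b1 := abs_integral_weight_mul_mul_le cR hF cA hL bA
    have b2 : ∀ k, |∫ y, P t y * U k t y * G k y| ≤
        L * (Real.sqrt (∫ y, U k t y ^ 2) * Real.sqrt (∫ y, G k y ^ 2)) :=
      fun k => abs_integral_weight_mul_mul_le (cU k) (hG k) cP hL bP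
    have b3 := abs_integral_weight_mul_mul_le cΘ hH cC hL bC
    have hs : ∑ k, 2 * (L * (Real.sqrt (∫ y, U k t y ^ 2) * Real.sqrt (∫ y, G k y ^ 2))) =
        2 * L * ∑ k, Real.sqrt (∫ y, U k t y ^ 2) * Real.sqrt (∫ y, G k y ^ 2) := by
      rw [Finset.mul_sum]; exact Finset.sum_congr rfl fun k _ => by ring
    calc |2 * (∫ y, A t y * R t y * F y) + (∑ k, 2 * ∫ y, P t y * U k t y * G k y) +
          2 * ∫ y, C t y * Θ t y * H y|
        ≤ |2 * ∫ y, A t y * R t y * F y| + |∑ k, 2 * ∫ y, P t y * U k t y * G k y| +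
          |2 * ∫ y, C t y * Θ t y * H y| := abs_add_three _ _ _
      _ ≤ 2 * (L * (Real.sqrt (∫ y, R t y ^ 2) * Real.sqrt (∫ y, F y ^ 2))) +
          (∑ k, 2 * (L * (Real.sqrt (∫ y, U k t y ^ 2) * Real.sqrt (∫ y, G k y ^ 2)))) +
          2 * (L * (Real.sqrt (∫ y, Θ t y ^ 2) * Real.sqrt (∫ y, H y ^ 2))) := by
          gcongr
          · rw [abs_mul, abs_two]; exact mul_le_mul_of_nonneg_left b1 (by norm_num)
          · exact (Finset.abs_sum_le_sum_abs _ _).trans (Finset.sum_le_sum fun k _ => by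
              rw [abs_mul, abs_two]; exact mul_le_mul_of_nonneg_left (b2 k) (by norm_num))
          · rw [abs_mul, abs_two]; exact mul_le_mul_of_nonneg_left b3 (by norm_num)
      _ = 2 * L * (Real.sqrt (∫ y, R t y ^ 2) * Real.sqrt (∫ y, F y ^ 2) +
          (∑ k, Real.sqrt (∫ y, U k t y ^ 2) * Real.sqrt (∫ y, G k y ^ 2)) +
          Real.sqrt (∫ y, Θ t y ^ 2) * Real.sqrt (∫ y, H y ^ 2)) := by
          rw [hs]; ring
  -- product derivative bounds
  have bprod : ∀ {a b : UnitAddTorus (Fin 3) → ℝ}, IsSmooth a → IsSmooth b → (∀ y, |a y| ≤ L) → (∀ y, |b y| ≤ L) →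
      (∀ i y, |partialDeriv i a y| ≤ L) → (∀ i y, |partialDeriv i b y| ≤ L) →
      ∀ i y, |partialDeriv i (fun y => a y * b y) y| ≤ 2 * L ^ 2 := by
    intro a b ha hb ba bb bax bbx i y
    rw [partialDeriv_mul (ha.isContDiff (by simp)) (hb.isContDiff (by simp))]
    calc |a y * partialDeriv i b y + partialDeriv i a y * b y|
        ≤ |a y| * |partialDeriv i b y| + |partialDeriv i a y| * |b y| := by
          rw [← abs_mul, ← abs_mul]; exact abs_add_le _ _
      _ ≤ L * L + L * L := add_le_add (mul_le_mul (ba y) (bbx i y) (abs_nonneg _) hL)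
          (mul_le_mul (bax i y) (bb y) (abs_nonneg _) hL)
      _ = 2 * L ^ 2 := by ring
  have bAu : ∀ i y, |partialDeriv i (fun y => A t y * uu i t y) y| ≤ 2 * L ^ 2 := fun i =>
    bprod sA (su i) bA (bu i) bAx (fun j => bux j i) i
  have bPu : ∀ i y, |partialDeriv i (fun y => P t y * uu i t y) y| ≤ 2 * L ^ 2 := fun i =>
    bprod sP (su i) bP (bu i) bPx (fun j => bux j i) i
  have bCu : ∀ i y, |partialDeriv i (fun y => C t y * uu i t y) y| ≤ 2 * L ^ 2 := fun i =>
    bprod sC (su i) bC (bu i) bCx (fun j => bux j i) i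
  have bAP : ∀ k y, |partialDeriv k (fun y => A t y * P t y) y| ≤ 2 * L ^ 2 := bprod sA sP bA bP bAx bPx
  have bPZ : ∀ k y, |partialDeriv k (fun y => P t y * Z t y) y| ≤ 2 * L ^ 2 := bprod sP sZ bP bZ bPx bZx
  -- (III)–(V)
  have bψ₁ : |∫ y, ψ₁ y| ≤ 3 * L ^ 2 * ∫ y, R t y ^ 2 := by
    have := abs_integral_transport_le (v := fun i => uu i t) sA su sR bAu
    simp only [hψ₁]; linarith
  have bψ₂ : ∀ k, |∫ y, ψ₂ k y| ≤ 3 * L ^ 2 * ∫ y, U k t y ^ 2 := fun k => by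
    have := abs_integral_transport_le (v := fun i => uu i t) sP su (sU k) bPu
    simp only [hψ₂]; linarith
  have bψ₃ : |∫ y, ψ₃ y| ≤ 3 * L ^ 2 * ∫ y, Θ t y ^ 2 := by
    have := abs_integral_transport_le (v := fun i => uu i t) sC su sΘ bCu
    simp only [hψ₃]; linarith
  have sAP : IsSmooth fun y => A t y * P t y := ContDiff.mul sA sP
  have sPZ : IsSmooth fun y => P t y * Z t y := ContDiff.mul sP sZ
  have hsum3 : ∀ (a : ℝ) (b : Fin 3 → ℝ), 2 * L ^ 2 / 2 * ∑ k, (a + b k) = L ^ 2 * (3 * a + ∑ k, b k) := by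
    intro a b
    rw [Finset.sum_add_distrib, Finset.sum_const, Finset.card_univ, Fintype.card_fin]
    simp only [nsmul_eq_mul, Nat.cast_ofNat]
    ring
  have bψ₄ : |∫ y, ψ₄ y| ≤ L ^ 2 * (3 * (∫ y, R t y ^ 2) + ∑ k, ∫ y, U k t y ^ 2) := by
    have h4 := abs_integral_coupling_le (h := fun k => U k t) sAP sR sU bAP
    rw [hsum3] at h4
    simpa only [hψ₄] using h4
  have bψ₅ : |∫ y, ψ₅ y| ≤ L ^ 2 * (3 * (∫ y, Θ t y ^ 2) + ∑ k, ∫ y, U k t y ^ 2) := by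
    have h5 := abs_integral_coupling_le (h := fun k => U k t) sPZ sΘ sU bPZ
    rw [hsum3] at h5
    simpa only [hψ₅] using h5
  have bψ₂s : |∑ k, ∫ y, ψ₂ k y| ≤ 3 * L ^ 2 * ∑ k, ∫ y, U k t y ^ 2 := by
    rw [Finset.mul_sum]
    exact (Finset.abs_sum_le_sum_abs _ _).trans (Finset.sum_le_sum fun k _ => bψ₂ k)
  -- conclusion
  rw [e0]
  have hsplit : |(∫ y, I y) + (∫ y, II y) - 2 * (∫ y, ψ₁ y) - 2 * (∑ k, ∫ y, ψ₂ k y) - 2 * (∫ y, ψ₃ y) -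
      2 * (∫ y, ψ₄ y) - 2 * ∫ y, ψ₅ y| ≤ |∫ y, I y| + |∫ y, II y| + 2 * |∫ y, ψ₁ y| +
      2 * |∑ k, ∫ y, ψ₂ k y| + 2 * |∫ y, ψ₃ y| + 2 * |∫ y, ψ₄ y| + 2 * |∫ y, ψ₅ y| := by
    have h := fun (p q : ℝ) => abs_sub p q
    have h' := fun (p q : ℝ) => abs_add_le p q
    calc _ ≤ |(∫ y, I y) + (∫ y, II y) - 2 * (∫ y, ψ₁ y) - 2 * (∑ k, ∫ y, ψ₂ k y) - 2 * (∫ y, ψ₃ y) -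
          2 * (∫ y, ψ₄ y)| + |2 * ∫ y, ψ₅ y| := h _ _
      _ ≤ |(∫ y, I y) + (∫ y, II y) - 2 * (∫ y, ψ₁ y) - 2 * (∑ k, ∫ y, ψ₂ k y) - 2 * (∫ y, ψ₃ y)| +
          |2 * ∫ y, ψ₄ y| + |2 * ∫ y, ψ₅ y| := by gcongr; exact h _ _
      _ ≤ |(∫ y, I y) + (∫ y, II y) - 2 * (∫ y, ψ₁ y) - 2 * (∑ k, ∫ y, ψ₂ k y)| + |2 * ∫ y, ψ₃ y| +
          |2 * ∫ y, ψ₄ y| + |2 * ∫ y, ψ₅ y| := by gcongr; exact h _ _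
      _ ≤ |(∫ y, I y) + (∫ y, II y) - 2 * (∫ y, ψ₁ y)| + |2 * ∑ k, ∫ y, ψ₂ k y| + |2 * ∫ y, ψ₃ y| +
          |2 * ∫ y, ψ₄ y| + |2 * ∫ y, ψ₅ y| := by gcongr; exact h _ _
      _ ≤ |(∫ y, I y) + (∫ y, II y)| + |2 * ∫ y, ψ₁ y| + |2 * ∑ k, ∫ y, ψ₂ k y| + |2 * ∫ y, ψ₃ y| +
          |2 * ∫ y, ψ₄ y| + |2 * ∫ y, ψ₅ y| := by gcongr; exact h _ _
      _ ≤ |∫ y, I y| + |∫ y, II y| + |2 * ∫ y, ψ₁ y| + |2 * ∑ k, ∫ y, ψ₂ k y| + |2 * ∫ y, ψ₃ y| +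
          |2 * ∫ y, ψ₄ y| + |2 * ∫ y, ψ₅ y| := by gcongr; exact h' _ _
      _ = _ := by simp only [abs_mul, abs_two]
  refine hsplit.trans ?_
  nlinarith [bI, bII, bψ₁, bψ₂s, bψ₃, bψ₄, bψ₅, nR0, nUs0, nΘ0, sq_nonneg L,
    mul_nonneg (sq_nonneg L) nR0, mul_nonneg (sq_nonneg L) nUs0, mul_nonneg (sq_nonneg L) nΘ0]

end CompressibleEuler

end Literature.Analysis.FluidPDE

end
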